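import Summits.Ventures.PackingBounds.Energy.TenPointCkSmall
import Summits.Ventures.PackingBounds.Energy.TenPointCkThree
import Summits.Ventures.PackingBounds.Energy.TenPointCkFourGroundState
import Summits.Ventures.PackingBounds.Energy.TenPointCkFiveGroundState
import Summits.Ventures.PackingBounds.Energy.TenPointCkSixGroundState
import Summits.Ventures.PackingBounds.Energy.TenPointPetersenAllK
import HarnessLib

/-!
# Ten points on `S³`: the least `(1+⟪x,y⟫)^k`-energy for EVERY `k ≥ 1`, and the crossover law

Framing: lottery ticket; floor = certified bounds/negative ranges. Venture `PackingBounds`, cell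
`pub-packcert`, energy family E3PT (pub-packcert-energy gen 16; assembly file).

Cohn–Woo (J. AMS 2012, §5.3) computed the three-point bounds for ten points on `S³` and the potentials `(1+t)^k`
and observed numerically: both the Petersen code and two orthogonal regular pentagons are optimal for `k ≤ 2`
(two-point bounds sharp), the pentagons win for `3 ≤ k ≤ 6`, the Petersen code wins for `k ≥ 7`. Every case is now a
kernel theorem of this tree (`TenPointCkSmall` k = 1, 2; `TenPointCkThree` k = 3; `TenPointCkFour/Five/Six*` k = 4, 5, 6
by exact sharp three-point certificates; `TenPointPetersenAllK` every k ≥ 7 by Cohn–Woo's finite-basis reduction over four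
exact certificates). This file assembles them into ONE statement: for every `k ≥ 1` the least value of
`Σ_{x ≠ y} (1+⟪x,y⟫)^k` over ten unit vectors of `ℝ⁴` is

* `pentagonValue k = 10·(2((3-√5)/4)^k + 2((3+√5)/4)^k + 5)` (two orthogonal regular pentagons) for `k ≤ 6`,
* `petersenValue k = 10·(3·(1/3)^k + 6·(7/6)^k)` (the Petersen code) for `k ≥ 7`,

together with the crossover law (`pentagonValue k = petersenValue k` for `k ≤ 2`, `<` for `3 ≤ k ≤ 6`, `>` for every `k ≥ 7`)
and uniqueness of the ground state up to isometry for every `k ≥ 4`.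
-/

noncomputable section

open Finset
open scoped RealInnerProductSpace

namespace Summit.Ventures.PackingBounds.Energy.TenPointCkAllK

open Summit.Ventures.PackingBounds.Config Summit.Ventures.PackingBounds.Energy

/-- The `(1+t)^k`-energy (ordered pairs) of two regular pentagons in orthogonal planes of `ℝ⁴`: per point, inner products
`cos 144° = (-1-√5)/4` and `cos 72° = (-1+√5)/4` twice each and `0` five times. -/
def pentagonValue (k : ℕ) : ℝ :=
  10 * (2 * ((3 - Real.sqrt 5) / 4) ^ k + 2 * ((3 + Real.sqrt 5) / 4) ^ k + 5)

/-- The `(1+t)^k`-energy (ordered pairs) of the Petersen code: per point, inner products `-2/3` three times and `1/6` six times. -/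
def petersenValue (k : ℕ) : ℝ := 10 * (3 * (1 / 3 : ℝ) ^ k + 6 * (7 / 6 : ℝ) ^ k)

/-- The least value: pentagons for `k ≤ 6`, Petersen for `k ≥ 7`. -/
def leastValue (k : ℕ) : ℝ := if k ≤ 6 then pentagonValue k else petersenValue k

/-- The set of `(1+t)^k`-energies of ten unit vectors of `ℝ⁴`. -/
def energySet (k : ℕ) : Set ℝ :=
  {E : ℝ | ∃ C : Finset (EuclideanSpace ℝ (Fin 4)), C.card = 10 ∧ (∀ x ∈ C, ‖x‖ = 1) ∧
    E = ∑ x ∈ C, ∑ y ∈ C.erase x, (1 + inner ℝ x y) ^ k}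

/-- Two orthogonal regular pentagons attain `pentagonValue k` (explicit configuration `Config.OrthogonalPentagons.exists_config`). -/
theorem pentagons_attain (k : ℕ) : pentagonValue k ∈ energySet k := by
  obtain ⟨C, hc, hn, _, he⟩ := OrthogonalPentagons.exists_config
  refine ⟨C, hc, hn, ?_⟩
  rw [he (fun t : ℝ => (1 + t) ^ k)]
  have e1 : (1 + (-1 - Real.sqrt 5) / 4) = (3 - Real.sqrt 5) / 4 := by ring
  have e2 : (1 + (-1 + Real.sqrt 5) / 4) = (3 + Real.sqrt 5) / 4 := by ring
  simp only [e1, e2, add_zero, one_pow, mul_one, pentagonValue]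

/-- The Petersen code attains `petersenValue k` (explicit configuration `Config.PetersenCode.exists_config`). -/
theorem petersen_attain (k : ℕ) : petersenValue k ∈ energySet k := by
  obtain ⟨C, hc, hn, _, he⟩ := PetersenCode.exists_config
  refine ⟨C, hc, hn, ?_⟩
  rw [he (fun t : ℝ => (1 + t) ^ k)]
  simp only [petersenValue]
  norm_num

/-- `√5 ^ 2 = 5`, `√5 ^ 4 = 25`, `√5 ^ 6 = 125`. -/
private theorem sqrt5_pows : Real.sqrt 5 ^ 2 = 5 ∧ Real.sqrt 5 ^ 4 = 25 ∧ Real.sqrt 5 ^ 6 = 125 := by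
  have hX : Real.sqrt 5 ^ 2 = 5 := Real.sq_sqrt (by norm_num)
  refine ⟨hX, ?_, ?_⟩
  · rw [show Real.sqrt 5 ^ 4 = (Real.sqrt 5 ^ 2) ^ 2 by ring, hX]; norm_num
  · rw [show Real.sqrt 5 ^ 6 = (Real.sqrt 5 ^ 2) ^ 3 by ring, hX]; norm_num

/-- The pentagon energies for `k ≤ 6` are rational: `80, 85, 95, 435/4, 1015/8, 1205/8`. -/
theorem pentagonValue_small :
    pentagonValue 1 = 80 ∧ pentagonValue 2 = 85 ∧ pentagonValue 3 = 95 ∧ pentagonValue 4 = (435 : ℝ) / 4 ∧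
      pentagonValue 5 = (1015 : ℝ) / 8 ∧ pentagonValue 6 = (1205 : ℝ) / 8 := by
  obtain ⟨hX, h4, h6⟩ := sqrt5_pows
  unfold pentagonValue
  refine ⟨?_, ?_, ?_, ?_, ?_, ?_⟩
  · ring
  · linear_combination ((5 : ℝ) / 2) * hX
  · linear_combination ((45 : ℝ) / 8) * hX
  · linear_combination ((135 : ℝ) / 16) * hX + ((5 : ℝ) / 32) * h4
  · linear_combination ((675 : ℝ) / 64) * hX + ((75 : ℝ) / 128) * h4
  · linear_combination ((6075 : ℝ) / 512) * hX + ((675 : ℝ) / 512) * h4 + ((5 : ℝ) / 512) * h6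

/-- `pentagonValue 7 = 5815/32 = 181.71875` (for the record: `> petersenValue 7 = 4118035/23328 ≈ 176.53`). -/
theorem pentagonValue_seven : pentagonValue 7 = (5815 : ℝ) / 32 := by
  obtain ⟨hX, h4, h6⟩ := sqrt5_pows
  unfold pentagonValue
  linear_combination ((25515 : ℝ) / 2048) * hX + ((4725 : ℝ) / 2048) * h4 + ((105 : ℝ) / 2048) * h6

/-- **Lower bound, every `k ≥ 1`.** For every ten unit vectors `C ⊂ ℝ⁴`: `Σ_{x ≠ y} (1+⟪x,y⟫)^k ≥ leastValue k`. -/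
theorem ck_ten_points (k : ℕ) (hk : 1 ≤ k) (C : Finset (EuclideanSpace ℝ (Fin 4))) (hC : ∀ x ∈ C, ‖x‖ = 1)
    (h10 : C.card = 10) : leastValue k ≤ ∑ x ∈ C, ∑ y ∈ C.erase x, (1 + inner ℝ x y) ^ k := by
  obtain ⟨p1, p2, p3, p4, p5, p6⟩ := pentagonValue_small
  unfold leastValue
  by_cases h6 : k ≤ 6
  · rw [if_pos h6]
    interval_cases k
    · rw [p1]; simpa only [pow_one] using TenPointCkSmall.ck1_ten_points C hC h10
    · rw [p2]; exact TenPointCkSmall.ck2_ten_points C hC h10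
    · rw [p3]; exact TenPointCkThree.ck3_ten_points C hC h10
    · rw [p4]; exact TenPointCkFour.ck4_ten_points C hC h10
    · rw [p5]; exact TenPointCkFive.ck5_ten_points C hC h10
    · rw [p6]; exact TenPointCkSix.ck6_ten_points C hC h10
  · rw [if_neg h6]
    exact TenPointPetersenAllK.petersen_ck_ten_points k (by omega) C hC h10

/-- **Ten points on `S³`, potential `(1+⟪x,y⟫)^k`, EVERY `k ≥ 1`, two-sided:** the least value of `Σ_{x ≠ y} (1+⟪x,y⟫)^k` over
ten unit vectors of `ℝ⁴` is `leastValue k` — the energy of two orthogonal regular pentagons for `k ≤ 6` and of the Petersen code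
for `k ≥ 7`. -/
theorem ck_ten_points_isLeast (k : ℕ) (hk : 1 ≤ k) : IsLeast (energySet k) (leastValue k) := by
  refine ⟨?_, ?_⟩
  · unfold leastValue
    split_ifs with h6
    · exact pentagons_attain k
    · exact petersen_attain k
  · rintro E ⟨C, h10, hC, rfl⟩
    exact ck_ten_points k hk C hC h10

/-- The same statement with the set written out. -/
theorem ck_ten_points_isLeast' (k : ℕ) (hk : 1 ≤ k) :
    IsLeast {E : ℝ | ∃ C : Finset (EuclideanSpace ℝ (Fin 4)), C.card = 10 ∧ (∀ x ∈ C, ‖x‖ = 1) ∧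
      E = ∑ x ∈ C, ∑ y ∈ C.erase x, (1 + inner ℝ x y) ^ k} (leastValue k) :=
  ck_ten_points_isLeast k hk

/-! ### The crossover law -/

/-- Ties for `k ≤ 2`: both codes have energy `90, 80, 85` at `k = 0, 1, 2` (both are spherical 2-designs). -/
theorem pentagonValue_eq_petersenValue (k : ℕ) (hk : k ≤ 2) : pentagonValue k = petersenValue k := by
  obtain ⟨p1, p2, -, -, -, -⟩ := pentagonValue_small
  interval_cases k
  · simp only [pentagonValue, petersenValue, pow_zero]; norm_num
  · rw [p1]; simp only [petersenValue]; norm_num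
  · rw [p2]; simp only [petersenValue]; norm_num

/-- Pentagons strictly better for `3 ≤ k ≤ 6`: `95 < 1735/18`, `435/4 < 4015/36`, `1015/8 < 84115/648`, `1205/8 < 196135/1296`. -/
theorem pentagonValue_lt_petersenValue (k : ℕ) (h3 : 3 ≤ k) (h6 : k ≤ 6) : pentagonValue k < petersenValue k := by
  obtain ⟨-, -, p3, p4, p5, p6⟩ := pentagonValue_small
  interval_cases k
  · rw [p3]; simp only [petersenValue]; norm_num
  · rw [p4]; simp only [petersenValue]; norm_num
  · rw [p5]; simp only [petersenValue]; norm_num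
  · rw [p6]; simp only [petersenValue]; norm_num

/-- `1.309 < (3+√5)/4` and `0 ≤ (3-√5)/4`. -/
private theorem node_bounds : (1309 : ℝ) / 1000 < (3 + Real.sqrt 5) / 4 ∧ 0 ≤ (3 - Real.sqrt 5) / 4 := by
  have hlo : (2236 : ℝ) / 1000 < Real.sqrt 5 := by
    rw [Real.lt_sqrt (by norm_num)]; norm_num
  have hhi : Real.sqrt 5 < 3 := by
    rw [Real.sqrt_lt' (by norm_num)]; norm_num
  constructor <;> linarith

/-- For `k ≥ 10` the leading Petersen term is already below the leading pentagon term: `6·(7/6)^k < 2·((3+√5)/4)^k`. -/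
private theorem lead_term (k : ℕ) (hk : 10 ≤ k) : 6 * (7 / 6 : ℝ) ^ k < 2 * ((3 + Real.sqrt 5) / 4) ^ k := by
  obtain ⟨ha, -⟩ := node_bounds
  set a := (3 + Real.sqrt 5) / 4 with ha_def
  induction k, hk using Nat.le_induction with
  | base =>
    have hp : ((1309 : ℝ) / 1000) ^ 10 ≤ a ^ 10 := pow_le_pow_left₀ (by norm_num) ha.le 10
    have hnum : 6 * (7 / 6 : ℝ) ^ 10 < 2 * ((1309 : ℝ) / 1000) ^ 10 := by norm_num
    linarith
  | succ n hn ih =>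
    have h76 : (7 / 6 : ℝ) ≤ a := by linarith
    have hpos : 0 ≤ 2 * a ^ n := by positivity
    calc 6 * (7 / 6 : ℝ) ^ (n + 1) = (7 / 6) * (6 * (7 / 6 : ℝ) ^ n) := by ring
      _ < (7 / 6) * (2 * a ^ n) := by apply mul_lt_mul_of_pos_left ih; norm_num
      _ ≤ a * (2 * a ^ n) := mul_le_mul_of_nonneg_right h76 hpos
      _ = 2 * a ^ (n + 1) := by ring

/-- The Petersen code strictly better for EVERY `k ≥ 7`. (`k = 7, 8, 9` numerically with `(3+√5)/4 > 1.309`; from `k = 10` on the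
leading terms alone decide, `lead_term`.) -/
theorem petersenValue_lt_pentagonValue (k : ℕ) (hk : 7 ≤ k) : petersenValue k < pentagonValue k := by
  obtain ⟨ha, hb⟩ := node_bounds
  have hbk : 0 ≤ ((3 - Real.sqrt 5) / 4) ^ k := pow_nonneg hb k
  have hak : ((1309 : ℝ) / 1000) ^ k ≤ ((3 + Real.sqrt 5) / 4) ^ k := pow_le_pow_left₀ (by norm_num) ha.le k
  unfold petersenValue pentagonValue
  by_cases h10 : 10 ≤ k
  · have hl := lead_term k h10
    have h3 : 3 * (1 / 3 : ℝ) ^ k ≤ 3 := by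
      have : (1 / 3 : ℝ) ^ k ≤ 1 := pow_le_one₀ (by norm_num) (by norm_num)
      linarith
    nlinarith
  · interval_cases k
    · have hnum : 3 * (1 / 3 : ℝ) ^ 7 + 6 * (7 / 6 : ℝ) ^ 7 < 2 * ((1309 : ℝ) / 1000) ^ 7 + 5 := by norm_num
      nlinarith
    · have hnum : 3 * (1 / 3 : ℝ) ^ 8 + 6 * (7 / 6 : ℝ) ^ 8 < 2 * ((1309 : ℝ) / 1000) ^ 8 + 5 := by norm_num
      nlinarith
    · have hnum : 3 * (1 / 3 : ℝ) ^ 9 + 6 * (7 / 6 : ℝ) ^ 9 < 2 * ((1309 : ℝ) / 1000) ^ 9 + 5 := by norm_num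
      nlinarith

/-- **Crossover law (one statement).** `leastValue k = min (pentagonValue k) (petersenValue k)` for every `k`, the minimum being
attained by the pentagons exactly for `k ≤ 6` and by the Petersen code exactly for `k ≤ 2 ∨ 7 ≤ k`. -/
theorem leastValue_eq_min (k : ℕ) : leastValue k = min (pentagonValue k) (petersenValue k) := by
  unfold leastValue
  split_ifs with h6
  · by_cases h2 : k ≤ 2
    · rw [pentagonValue_eq_petersenValue k h2, min_self]
    · exact (min_eq_left (pentagonValue_lt_petersenValue k (by omega) h6).le).symm
  · exact (min_eq_right (petersenValue_lt_pentagonValue k (by omega)).le).symm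

/-! ### Uniqueness of the ground state, every `k ≥ 4` -/

/-- **Uniqueness up to isometry, every `k ≥ 4`:** any two minimisers of the `(1+t)^k`-energy of ten points on `S³` are related by a
linear isometry of `ℝ⁴` (two orthogonal regular pentagons for `4 ≤ k ≤ 6`, the Petersen code for `k ≥ 7`). (For `k ≤ 3` the minimiser
is not unique: every ten-point 2-design ties at `k ≤ 2`, every 3-design at `k = 3`.) -/
theorem minimisers_isometric (k : ℕ) (hk : 4 ≤ k) (C C' : Finset (EuclideanSpace ℝ (Fin 4)))
    (hC : ∀ x ∈ C, ‖x‖ = 1) (h10 : C.card = 10)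
    (hmin : ∑ x ∈ C, ∑ y ∈ C.erase x, (1 + inner ℝ x y) ^ k = leastValue k)
    (hC' : ∀ x ∈ C', ‖x‖ = 1) (h10' : C'.card = 10)
    (hmin' : ∑ x ∈ C', ∑ y ∈ C'.erase x, (1 + inner ℝ x y) ^ k = leastValue k) :
    ∃ Ψ : EuclideanSpace ℝ (Fin 4) ≃ₗᵢ[ℝ] EuclideanSpace ℝ (Fin 4), C' = C.image Ψ := by
  obtain ⟨-, -, -, p4, p5, p6⟩ := pentagonValue_small
  unfold leastValue at hmin hmin'
  by_cases h6 : k ≤ 6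
  · rw [if_pos h6] at hmin hmin'
    interval_cases k
    · rw [p4] at hmin hmin'; exact TenPointCkFour.minimisers_isometric C C' hC h10 hmin hC' h10' hmin'
    · rw [p5] at hmin hmin'; exact TenPointCkFive.minimisers_isometric C C' hC h10 hmin hC' h10' hmin'
    · rw [p6] at hmin hmin'; exact TenPointCkSix.minimisers_isometric C C' hC h10 hmin hC' h10' hmin'
  · rw [if_neg h6] at hmin hmin'
    exact TenPointPetersenAllK.minimisers_isometric k (by omega) C C' hC h10 hmin hC' h10' hmin'

end Summit.Ventures.PackingBounds.Energy.TenPointCkAllK
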